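import Mathlib.RingTheory.Localization.Integral
import Mathlib.FieldTheory.Separable
import Mathlib.Algebra.Polynomial.Derivative
import HarnessLib

/-!
# An integral Bézout certificate `c_u f + c_v f' = D` for an integer polynomial separable over `ℚ`

For `f ∈ ℤ[T]` whose image in `ℚ[T]` is separable there are `c_u, c_v ∈ ℤ[T]` and an integer
`D ≠ 0` with `c_u f + c_v f' = D` (Lang, *Algebra*, IV §8: the resultant `Res(f, f')` — a non-zero
integer for `f` separable — is such a combination with coefficients integral polynomials in the
coefficients of `f`; here we only record the existence of SOME non-zero `D`, by clearing the
denominators of a Bézout identity over `ℚ`, Mathlib `IsLocalization.integerNormalization`).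

* `Polynomial.exists_int_certificate_of_separable_map` — the statement above.

This is the hypothesis `c_u f + c_v f' = D` of the equivariant Poincaré complements for CM orders
(`Motives/AbelianVarietyPoincareEquivariantPolynomial`, `…PoincareEquivariantPerfectField`), e.g.
for `f` the minimal polynomial of a generator of an order in a number field. Everything is proved;
no definition, no named fact (D-0026).

## References

* S. Lang, *Algebra*, rev. 3rd ed., GTM 211 (2002), Ch. IV §8 (the resultant; `R(f, g) = u f + v g`
  with `u, v` integral in the coefficients). [Lang2002]
-/

noncomputable section

open Polynomial
open scoped Polynomial nonZeroDivisors

namespace Polynomial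

/-- **Integral Bézout certificate for a polynomial separable over `ℚ`**: if `f ∈ ℤ[T]` becomes
separable in `ℚ[T]`, then `c_u f + c_v f' = D` for some `c_u, c_v ∈ ℤ[T]` and an integer `D ≠ 0`
(clear denominators in a Bézout identity `a f + b f' = 1` over `ℚ`). [cite: Lang2002, Ch. IV §8 (resultant)] -/
theorem exists_int_certificate_of_separable_map (f : ℤ[X])
    (hf : (f.map (Int.castRingHom ℚ)).Separable) :
    ∃ (cu cv : ℤ[X]) (D : ℤ), D ≠ 0 ∧ cu * f + cv * derivative f = C D := by
  obtain ⟨a, b, hab⟩ := hf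
  rw [derivative_map] at hab
  obtain ⟨da, hda, ha⟩ := IsLocalization.integerNormalization_spec ℤ⁰ a
  obtain ⟨db, hdb, hb⟩ := IsLocalization.integerNormalization_spec ℤ⁰ b
  have hda0 : da ≠ 0 := nonZeroDivisors.ne_zero hda
  have hdb0 : db ≠ 0 := nonZeroDivisors.ne_zero hdb
  refine ⟨C db * IsLocalization.integerNormalization ℤ⁰ a, C da * IsLocalization.integerNormalization ℤ⁰ b,
    da * db, mul_ne_zero hda0 hdb0, ?_⟩
  apply Polynomial.map_injective (Int.castRingHom ℚ) Int.cast_injective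
  change Polynomial.map (algebraMap ℤ ℚ) _ = Polynomial.map (algebraMap ℤ ℚ) _
  simp only [Polynomial.map_add, Polynomial.map_mul, Polynomial.map_C, ha, hb]
  rw [zsmul_eq_mul, zsmul_eq_mul, ← C_eq_intCast, ← C_eq_intCast]
  simp only [eq_intCast, Int.cast_mul, C_mul]
  change _ = _ at hab
  linear_combination (C (da : ℚ) * C (db : ℚ)) * hab

end Polynomial
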